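import Summits.Ventures.PercRepro.S1CFGCrude
import Summits.Ventures.PercRepro.S1CFGSimpleFiveValues

/-!
# PercRepro — THE CRUDE N-CAPS AT NULLITY `5` ON `13` AND `14` POINTS, BY NUMBER (p1, gen 38)

The numerals of S1CFGCrude at `ν = 5` for a loopless coloop-free (NOT necessarily simple) matroid on `n = 13 / 14` points —
the regime ν = 5 of p7's cell `(13, 10)` has `N = M ／ V` of nullity `5` on `13` or `14` points. Rank forms
`{X | X ⊆ E ∧ |X| = k ∧ rk X ≤ s}.ncard`:

| `n` | `Q₂¹ = D₂` | `Q₃¹` | `Q₄¹` | `Q₅¹` | `Q₃² = D₃` | `Q₄²` | `Q₄³ = D₄` | `Q₅²` | `Q₅³` |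
|---|---|---|---|---|---|---|---|---|---|
| 13 | 10 | 10 | 5 | 1 | 145 | 133 | 970 | 62 | 821 |
| 14 | 10 | 10 | 5 | 1 | 155 | 143 | 1115 | 67 | 955 |

(`Q₅⁴` from `five_mul_ncard_five_eRk_le_four_le` exceeds `C(n, 5)` here and is not instantiated.) Nothing about any cell is
claimed. Axioms: standard.
-/

open scoped Matroid

namespace PercRepro

namespace S1CFG

open Set S1CF

variable {α : Type}

/-- `D₂ ≤ 10` at nullity `5` on `n ≥ 11` points. -/
theorem ncard_dep_pairs_le_ten_of_five (M : Matroid α) [M.Finite] (hL : ∀ e ∈ M.E, ¬ M.IsLoop e)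
    (hK : ∀ e, ¬ M.IsColoop e) (hd : M.E.encard = M.eRank + ((5 : ℕ) : ℕ∞)) (hn : 11 ≤ M.E.ncard) :
    {P : Set α | P ⊆ M.E ∧ P.ncard = 2 ∧ M.Dep P}.ncard ≤ 10 := by
  have := ncard_dep_pairs_le_choose M hL hK hd (by omega)
  have hc : (5 : ℕ).choose 2 = 10 := by decide
  rw [hc] at this
  exact this

/-- `Q₂¹ ≤ 10` at nullity `5` on `n ≥ 11` points (rank form). -/
theorem ncard_two_eRk_le_one_le_ten_of_five (M : Matroid α) [M.Finite] (hL : ∀ e ∈ M.E, ¬ M.IsLoop e)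
    (hK : ∀ e, ¬ M.IsColoop e) (hd : M.E.encard = M.eRank + ((5 : ℕ) : ℕ∞)) (hn : 11 ≤ M.E.ncard) :
    {X : Set α | X ⊆ M.E ∧ X.ncard = 2 ∧ M.eRk X ≤ 1}.ncard ≤ 10 :=
  (Set.ncard_le_ncard (two_eRk_le_one_subset_dep M)
    (M.ground_finite.finite_subsets.subset (fun _ hX => hX.1))).trans
    (ncard_dep_pairs_le_ten_of_five M hL hK hd hn)

/-- `Q₃¹ ≤ 10` at nullity `5` on `n ≥ 11` points. -/
theorem ncard_three_eRk_le_one_le_ten_of_five (M : Matroid α) [M.Finite] (hL : ∀ e ∈ M.E, ¬ M.IsLoop e)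
    (hK : ∀ e, ¬ M.IsColoop e) (hd : M.E.encard = M.eRank + ((5 : ℕ) : ℕ∞)) (hn : 11 ≤ M.E.ncard) :
    {X : Set α | X ⊆ M.E ∧ X.ncard = 3 ∧ M.eRk X ≤ 1}.ncard ≤ 10 := by
  have hr := eRk_ground_toNat_eq_of_five M hd
  have h1 := three_mul_ncard_three_eRk_le_one_le M hL hK hd (by omega)
  have h2 := ncard_two_eRk_le_one_le_ten_of_five M hL hK hd hn
  have h3 : (5 - 2) * {X : Set α | X ⊆ M.E ∧ X.ncard = 2 ∧ M.eRk X ≤ 1}.ncard ≤ (5 - 2) * 10 :=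
    Nat.mul_le_mul_left _ h2
  omega

/-- `Q₄¹ ≤ 5` at nullity `5` on `n ≥ 11` points. -/
theorem ncard_four_eRk_le_one_le_five_of_five (M : Matroid α) [M.Finite] (hL : ∀ e ∈ M.E, ¬ M.IsLoop e)
    (hK : ∀ e, ¬ M.IsColoop e) (hd : M.E.encard = M.eRank + ((5 : ℕ) : ℕ∞)) (hn : 11 ≤ M.E.ncard) :
    {X : Set α | X ⊆ M.E ∧ X.ncard = 4 ∧ M.eRk X ≤ 1}.ncard ≤ 5 := by
  have hr := eRk_ground_toNat_eq_of_five M hd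
  have h1 := four_mul_ncard_four_eRk_le_one_le M hL hK hd (by omega)
  have h2 := ncard_three_eRk_le_one_le_ten_of_five M hL hK hd hn
  have h3 : (5 - 3) * {X : Set α | X ⊆ M.E ∧ X.ncard = 3 ∧ M.eRk X ≤ 1}.ncard ≤ (5 - 3) * 10 :=
    Nat.mul_le_mul_left _ h2
  omega

/-- `Q₅¹ ≤ 1` at nullity `5` on `n ≥ 11` points. -/
theorem ncard_five_eRk_le_one_le_one_of_five (M : Matroid α) [M.Finite] (hL : ∀ e ∈ M.E, ¬ M.IsLoop e)
    (hK : ∀ e, ¬ M.IsColoop e) (hd : M.E.encard = M.eRank + ((5 : ℕ) : ℕ∞)) (hn : 11 ≤ M.E.ncard) :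
    {X : Set α | X ⊆ M.E ∧ X.ncard = 5 ∧ M.eRk X ≤ 1}.ncard ≤ 1 := by
  have hr := eRk_ground_toNat_eq_of_five M hd
  have h1 := five_mul_ncard_five_eRk_le_one_le M hL hK hd (by omega)
  have h2 := ncard_four_eRk_le_one_le_five_of_five M hL hK hd hn
  have h3 : (5 - 4) * {X : Set α | X ⊆ M.E ∧ X.ncard = 4 ∧ M.eRk X ≤ 1}.ncard ≤ (5 - 4) * 5 :=
    Nat.mul_le_mul_left _ h2
  omega

/-- `Q₃² ≤ 10 · (n − 2) + 35` at nullity `5` on `n ≥ 11` points. -/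
theorem ncard_three_eRk_le_two_le_of_five (M : Matroid α) [M.Finite] (hL : ∀ e ∈ M.E, ¬ M.IsLoop e)
    (hK : ∀ e, ¬ M.IsColoop e) (hd : M.E.encard = M.eRank + ((5 : ℕ) : ℕ∞)) (hn : 11 ≤ M.E.ncard) :
    {X : Set α | X ⊆ M.E ∧ X.ncard = 3 ∧ M.eRk X ≤ 2}.ncard ≤ (M.E.ncard - 2) * 10 + 35 := by
  have h1 := ncard_three_eRk_le_two_le_split M hd
  have h2 := ncard_dep_pairs_le_ten_of_five M hL hK hd hn
  have hc : (5 + 2 : ℕ).choose 3 = 35 := by decide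
  rw [hc] at h1
  have h3 : (M.E.ncard - 2) * {P : Set α | P ⊆ M.E ∧ P.ncard = 2 ∧ M.Dep P}.ncard ≤ (M.E.ncard - 2) * 10 :=
    Nat.mul_le_mul_left _ h2
  omega

/-- `Q₄² ≤ 133` at nullity `5` on `13` points. -/
theorem ncard_four_eRk_le_two_le_thirteen_of_five (M : Matroid α) [M.Finite] (hL : ∀ e ∈ M.E, ¬ M.IsLoop e)
    (hK : ∀ e, ¬ M.IsColoop e) (hd : M.E.encard = M.eRank + ((5 : ℕ) : ℕ∞)) (hn : M.E.ncard = 13) :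
    {X : Set α | X ⊆ M.E ∧ X.ncard = 4 ∧ M.eRk X ≤ 2}.ncard ≤ 133 := by
  have hr := eRk_ground_toNat_eq_of_five M hd
  have h1 := four_mul_ncard_four_eRk_le_two_le M hK hd (by omega)
  have h2 := ncard_three_eRk_le_two_le_of_five M hL hK hd (by omega)
  have h3 := ncard_three_eRk_le_one_le_ten_of_five M hL hK hd (by omega)
  rw [hn] at h1 h2
  have h4 : (5 - 2) * {X : Set α | X ⊆ M.E ∧ X.ncard = 3 ∧ M.eRk X ≤ 2}.ncard ≤ (5 - 2) * ((13 - 2) * 10 + 35) :=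
    Nat.mul_le_mul_left _ h2
  have h5 : (13 - 3) * {X : Set α | X ⊆ M.E ∧ X.ncard = 3 ∧ M.eRk X ≤ 1}.ncard ≤ (13 - 3) * 10 :=
    Nat.mul_le_mul_left _ h3
  omega

/-- `Q₄³ ≤ 970` at nullity `5` on `13` points. -/
theorem ncard_four_eRk_le_three_le_thirteen_of_five (M : Matroid α) [M.Finite] (hL : ∀ e ∈ M.E, ¬ M.IsLoop e)
    (hK : ∀ e, ¬ M.IsColoop e) (hd : M.E.encard = M.eRank + ((5 : ℕ) : ℕ∞)) (hn : M.E.ncard = 13) :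
    {X : Set α | X ⊆ M.E ∧ X.ncard = 4 ∧ M.eRk X ≤ 3}.ncard ≤ 970 := by
  have h1 := ncard_four_eRk_le_three_le_split M hd
  have h2 := ncard_dep_pairs_le_ten_of_five M hL hK hd (by omega)
  rw [hn] at h1
  have hc2 : (13 - 2 : ℕ).choose 2 = 55 := by decide
  have hc3 : (5 + 2 : ℕ).choose 3 = 35 := by decide
  have hc4 : (5 + 3 : ℕ).choose 4 = 70 := by decide
  rw [hc2, hc3, hc4] at h1
  have h3 : 55 * {P : Set α | P ⊆ M.E ∧ P.ncard = 2 ∧ M.Dep P}.ncard ≤ 55 * 10 :=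
    Nat.mul_le_mul_left _ h2
  omega

/-- `Q₅² ≤ 62` at nullity `5` on `13` points. -/
theorem ncard_five_eRk_le_two_le_thirteen_of_five (M : Matroid α) [M.Finite] (hL : ∀ e ∈ M.E, ¬ M.IsLoop e)
    (hK : ∀ e, ¬ M.IsColoop e) (hd : M.E.encard = M.eRank + ((5 : ℕ) : ℕ∞)) (hn : M.E.ncard = 13) :
    {X : Set α | X ⊆ M.E ∧ X.ncard = 5 ∧ M.eRk X ≤ 2}.ncard ≤ 62 := by
  have hr := eRk_ground_toNat_eq_of_five M hd
  have h1 := five_mul_ncard_five_eRk_le_two_le M hK hd (by omega)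
  have h2 := ncard_four_eRk_le_two_le_thirteen_of_five M hL hK hd hn
  have h3 := ncard_four_eRk_le_one_le_five_of_five M hL hK hd (by omega)
  rw [hn] at h1
  have h4 : (5 - 3) * {X : Set α | X ⊆ M.E ∧ X.ncard = 4 ∧ M.eRk X ≤ 2}.ncard ≤ (5 - 3) * 133 :=
    Nat.mul_le_mul_left _ h2
  have h5 : (13 - 4) * {X : Set α | X ⊆ M.E ∧ X.ncard = 4 ∧ M.eRk X ≤ 1}.ncard ≤ (13 - 4) * 5 :=
    Nat.mul_le_mul_left _ h3
  omega

/-- `Q₅³ ≤ 821` at nullity `5` on `13` points. -/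
theorem ncard_five_eRk_le_three_le_thirteen_of_five (M : Matroid α) [M.Finite] (hL : ∀ e ∈ M.E, ¬ M.IsLoop e)
    (hK : ∀ e, ¬ M.IsColoop e) (hd : M.E.encard = M.eRank + ((5 : ℕ) : ℕ∞)) (hn : M.E.ncard = 13) :
    {X : Set α | X ⊆ M.E ∧ X.ncard = 5 ∧ M.eRk X ≤ 3}.ncard ≤ 821 := by
  have hr := eRk_ground_toNat_eq_of_five M hd
  have h1 := five_mul_ncard_five_eRk_le_three_le M hK hd (by omega)
  have h2 := ncard_four_eRk_le_three_le_thirteen_of_five M hL hK hd hn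
  have h3 := ncard_four_eRk_le_two_le_thirteen_of_five M hL hK hd hn
  rw [hn] at h1
  have h4 : (5 - 2) * {X : Set α | X ⊆ M.E ∧ X.ncard = 4 ∧ M.eRk X ≤ 3}.ncard ≤ (5 - 2) * 970 :=
    Nat.mul_le_mul_left _ h2
  have h5 : (13 - 4) * {X : Set α | X ⊆ M.E ∧ X.ncard = 4 ∧ M.eRk X ≤ 2}.ncard ≤ (13 - 4) * 133 :=
    Nat.mul_le_mul_left _ h3
  omega

/-- `Q₄² ≤ 143` at nullity `5` on `14` points. -/
theorem ncard_four_eRk_le_two_le_fourteen_of_five (M : Matroid α) [M.Finite] (hL : ∀ e ∈ M.E, ¬ M.IsLoop e)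
    (hK : ∀ e, ¬ M.IsColoop e) (hd : M.E.encard = M.eRank + ((5 : ℕ) : ℕ∞)) (hn : M.E.ncard = 14) :
    {X : Set α | X ⊆ M.E ∧ X.ncard = 4 ∧ M.eRk X ≤ 2}.ncard ≤ 143 := by
  have hr := eRk_ground_toNat_eq_of_five M hd
  have h1 := four_mul_ncard_four_eRk_le_two_le M hK hd (by omega)
  have h2 := ncard_three_eRk_le_two_le_of_five M hL hK hd (by omega)
  have h3 := ncard_three_eRk_le_one_le_ten_of_five M hL hK hd (by omega)
  rw [hn] at h1 h2
  have h4 : (5 - 2) * {X : Set α | X ⊆ M.E ∧ X.ncard = 3 ∧ M.eRk X ≤ 2}.ncard ≤ (5 - 2) * ((14 - 2) * 10 + 35) :=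
    Nat.mul_le_mul_left _ h2
  have h5 : (14 - 3) * {X : Set α | X ⊆ M.E ∧ X.ncard = 3 ∧ M.eRk X ≤ 1}.ncard ≤ (14 - 3) * 10 :=
    Nat.mul_le_mul_left _ h3
  omega

/-- `Q₄³ ≤ 1115` at nullity `5` on `14` points. -/
theorem ncard_four_eRk_le_three_le_fourteen_of_five (M : Matroid α) [M.Finite] (hL : ∀ e ∈ M.E, ¬ M.IsLoop e)
    (hK : ∀ e, ¬ M.IsColoop e) (hd : M.E.encard = M.eRank + ((5 : ℕ) : ℕ∞)) (hn : M.E.ncard = 14) :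
    {X : Set α | X ⊆ M.E ∧ X.ncard = 4 ∧ M.eRk X ≤ 3}.ncard ≤ 1115 := by
  have h1 := ncard_four_eRk_le_three_le_split M hd
  have h2 := ncard_dep_pairs_le_ten_of_five M hL hK hd (by omega)
  rw [hn] at h1
  have hc2 : (14 - 2 : ℕ).choose 2 = 66 := by decide
  have hc3 : (5 + 2 : ℕ).choose 3 = 35 := by decide
  have hc4 : (5 + 3 : ℕ).choose 4 = 70 := by decide
  rw [hc2, hc3, hc4] at h1
  have h3 : 66 * {P : Set α | P ⊆ M.E ∧ P.ncard = 2 ∧ M.Dep P}.ncard ≤ 66 * 10 :=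
    Nat.mul_le_mul_left _ h2
  omega

/-- `Q₅² ≤ 67` at nullity `5` on `14` points. -/
theorem ncard_five_eRk_le_two_le_fourteen_of_five (M : Matroid α) [M.Finite] (hL : ∀ e ∈ M.E, ¬ M.IsLoop e)
    (hK : ∀ e, ¬ M.IsColoop e) (hd : M.E.encard = M.eRank + ((5 : ℕ) : ℕ∞)) (hn : M.E.ncard = 14) :
    {X : Set α | X ⊆ M.E ∧ X.ncard = 5 ∧ M.eRk X ≤ 2}.ncard ≤ 67 := by
  have hr := eRk_ground_toNat_eq_of_five M hd
  have h1 := five_mul_ncard_five_eRk_le_two_le M hK hd (by omega)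
  have h2 := ncard_four_eRk_le_two_le_fourteen_of_five M hL hK hd hn
  have h3 := ncard_four_eRk_le_one_le_five_of_five M hL hK hd (by omega)
  rw [hn] at h1
  have h4 : (5 - 3) * {X : Set α | X ⊆ M.E ∧ X.ncard = 4 ∧ M.eRk X ≤ 2}.ncard ≤ (5 - 3) * 143 :=
    Nat.mul_le_mul_left _ h2
  have h5 : (14 - 4) * {X : Set α | X ⊆ M.E ∧ X.ncard = 4 ∧ M.eRk X ≤ 1}.ncard ≤ (14 - 4) * 5 :=
    Nat.mul_le_mul_left _ h3
  omega

/-- `Q₅³ ≤ 955` at nullity `5` on `14` points. -/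
theorem ncard_five_eRk_le_three_le_fourteen_of_five (M : Matroid α) [M.Finite] (hL : ∀ e ∈ M.E, ¬ M.IsLoop e)
    (hK : ∀ e, ¬ M.IsColoop e) (hd : M.E.encard = M.eRank + ((5 : ℕ) : ℕ∞)) (hn : M.E.ncard = 14) :
    {X : Set α | X ⊆ M.E ∧ X.ncard = 5 ∧ M.eRk X ≤ 3}.ncard ≤ 955 := by
  have hr := eRk_ground_toNat_eq_of_five M hd
  have h1 := five_mul_ncard_five_eRk_le_three_le M hK hd (by omega)
  have h2 := ncard_four_eRk_le_three_le_fourteen_of_five M hL hK hd hn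
  have h3 := ncard_four_eRk_le_two_le_fourteen_of_five M hL hK hd hn
  rw [hn] at h1
  have h4 : (5 - 2) * {X : Set α | X ⊆ M.E ∧ X.ncard = 4 ∧ M.eRk X ≤ 3}.ncard ≤ (5 - 2) * 1115 :=
    Nat.mul_le_mul_left _ h2
  have h5 : (14 - 4) * {X : Set α | X ⊆ M.E ∧ X.ncard = 4 ∧ M.eRk X ≤ 2}.ncard ≤ (14 - 4) * 143 :=
    Nat.mul_le_mul_left _ h3
  omega

end S1CFG

end PercRepro
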